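import Mathlib
import Summits.Ventures.PercRepro2.CoinOrTailAlg
import Summits.Ventures.PercRepro2.CoinOrTail3Cells

/-!
# Four-marker cell sums (blind cell PercRepro2, night-2 g9; proofs/NIGHT2-DARC.md §36)

The cell machinery of `CoinOrTailAlg.lean` for FOUR markers `p, r, u, q`: the cell weights
`cellWt4`, the cell sums `cellSum4 … bp br bu bq X = Σ_{W ⊆ U} ν W · 1[cell (bp, br, bu, bq)] · A (W ∪ X)`,
their Ahlswede–Daykin step `cellSum4_mul_le` (meet = `&&` / `∩`, join = `||` / `∪`), their
monotone step `cellSum4_mono`, and the good-set weight `goodWt2 p r u` (`1` iff `u ∈ W → r ∈ W → p ∈ W`)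
with which a sum over a weight vanishing on the bad sets is restricted to the good ones
(`sum_eq_sum_goodWt2`, `sum_eq_sum_goodWt2'`).  Used by `orTail3_functional_nonneg`
(CoinOrTailFar2Alg.lean) to lift the (3,1)-core certificate `D31Pr_cert`.
-/

namespace Summit.Ventures.PercRepro2.Coin

section OrTail4Cells

variable {V : Type*} [DecidableEq V] {R : Type*} [Field R] [LinearOrder R] [IsStrictOrderedRing R]

/-- The cell weight of the four-marker pattern `(bp, br, bu, bq)`. -/
def cellWt4 (p r u q : V) (bp br bu bq : Bool) (W : Finset V) : R :=
  mWt p bp W * mWt r br W * mWt u bu W * mWt q bq W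

/-- A four-marker cell sum: `Σ_{W ⊆ U} ν W · cellWt4 bp br bu bq W · A (W ∪ X)`. -/
def cellSum4 (U : Finset V) (ν A : Finset V → R) (p r u q : V) (bp br bu bq : Bool) (X : Finset V) :
    R :=
  ∑ W ∈ U.powerset, ν W * cellWt4 (R := R) p r u q bp br bu bq W * A (W ∪ X)

/-- `cellWt4` is nonnegative. -/
lemma cellWt4_nonneg (p r u q : V) (bp br bu bq : Bool) (W : Finset V) :
    0 ≤ cellWt4 (R := R) p r u q bp br bu bq W :=
  mul_nonneg (mul_nonneg (mul_nonneg (mWt_nonneg _ _ _) (mWt_nonneg _ _ _)) (mWt_nonneg _ _ _))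
    (mWt_nonneg _ _ _)

/-- The four-marker cell weights are compatible with `∩` and `∪`. -/
lemma cellWt4_mul_le (p r u q : V) (bp br bu bq bp' br' bu' bq' : Bool) (s t : Finset V) :
    cellWt4 (R := R) p r u q bp br bu bq s * cellWt4 p r u q bp' br' bu' bq' t ≤
      cellWt4 p r u q (bp && bp') (br && br') (bu && bu') (bq && bq') (s ∩ t) *
        cellWt4 p r u q (bp || bp') (br || br') (bu || bu') (bq || bq') (s ∪ t) := by
  unfold cellWt4
  calc mWt (R := R) p bp s * mWt r br s * mWt u bu s * mWt q bq s *
        (mWt p bp' t * mWt r br' t * mWt u bu' t * mWt q bq' t)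
      = (mWt p bp s * mWt p bp' t) * (mWt r br s * mWt r br' t) * (mWt u bu s * mWt u bu' t) *
          (mWt q bq s * mWt q bq' t) := by ring
    _ ≤ (mWt p (bp && bp') (s ∩ t) * mWt p (bp || bp') (s ∪ t)) *
          (mWt r (br && br') (s ∩ t) * mWt r (br || br') (s ∪ t)) *
          (mWt u (bu && bu') (s ∩ t) * mWt u (bu || bu') (s ∪ t)) *
          (mWt q (bq && bq') (s ∩ t) * mWt q (bq || bq') (s ∪ t)) := by
        apply mul_le_mul
        · apply mul_le_mul
          · apply mul_le_mul (mWt_mul_le p bp bp' s t) (mWt_mul_le r br br' s t)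
            · exact mul_nonneg (mWt_nonneg _ _ _) (mWt_nonneg _ _ _)
            · exact mul_nonneg (mWt_nonneg _ _ _) (mWt_nonneg _ _ _)
          · exact mWt_mul_le u bu bu' s t
          · exact mul_nonneg (mWt_nonneg _ _ _) (mWt_nonneg _ _ _)
          · exact mul_nonneg (mul_nonneg (mWt_nonneg _ _ _) (mWt_nonneg _ _ _))
              (mul_nonneg (mWt_nonneg _ _ _) (mWt_nonneg _ _ _))
        · exact mWt_mul_le q bq bq' s t
        · exact mul_nonneg (mWt_nonneg _ _ _) (mWt_nonneg _ _ _)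
        · exact mul_nonneg (mul_nonneg (mul_nonneg (mWt_nonneg _ _ _) (mWt_nonneg _ _ _))
            (mul_nonneg (mWt_nonneg _ _ _) (mWt_nonneg _ _ _)))
            (mul_nonneg (mWt_nonneg _ _ _) (mWt_nonneg _ _ _))
    _ = mWt p (bp && bp') (s ∩ t) * mWt r (br && br') (s ∩ t) * mWt u (bu && bu') (s ∩ t) *
          mWt q (bq && bq') (s ∩ t) *
          (mWt p (bp || bp') (s ∪ t) * mWt r (br || br') (s ∪ t) * mWt u (bu || bu') (s ∪ t) *
            mWt q (bq || bq') (s ∪ t)) := by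
        ring

/-- **The log-supermodular step of the four-marker cell sums** (Ahlswede–Daykin). -/
theorem cellSum4_mul_le (U : Finset V) (ν A : Finset V → R) (p r u q : V)
    (hν0 : ∀ W, 0 ≤ ν W) (hν : ∀ s ⊆ U, ∀ t ⊆ U, ν s * ν t ≤ ν (s ∩ t) * ν (s ∪ t))
    (hA0 : ∀ W, 0 ≤ A W) (hA : ∀ s t : Finset V, A s * A t ≤ A (s ∩ t) * A (s ∪ t))
    (bp br bu bq bp' br' bu' bq' : Bool) (X Y : Finset V) (hXU : Disjoint X U) (hYU : Disjoint Y U) :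
    cellSum4 U ν A p r u q bp br bu bq X * cellSum4 U ν A p r u q bp' br' bu' bq' Y ≤
      cellSum4 U ν A p r u q (bp && bp') (br && br') (bu && bu') (bq && bq') (X ∩ Y) *
        cellSum4 U ν A p r u q (bp || bp') (br || br') (bu || bu') (bq || bq') (X ∪ Y) := by
  unfold cellSum4
  have h₁ : (0 : Finset V → R) ≤ fun W => ν W * cellWt4 p r u q bp br bu bq W * A (W ∪ X) :=
    fun W => mul_nonneg (mul_nonneg (hν0 W) (cellWt4_nonneg _ _ _ _ _ _ _ _ _)) (hA0 _)
  have h₂ : (0 : Finset V → R) ≤ fun W => ν W * cellWt4 p r u q bp' br' bu' bq' W * A (W ∪ Y) :=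
    fun W => mul_nonneg (mul_nonneg (hν0 W) (cellWt4_nonneg _ _ _ _ _ _ _ _ _)) (hA0 _)
  have h₃ : (0 : Finset V → R) ≤
      fun W => ν W * cellWt4 p r u q (bp && bp') (br && br') (bu && bu') (bq && bq') W * A (W ∪ (X ∩ Y)) :=
    fun W => mul_nonneg (mul_nonneg (hν0 W) (cellWt4_nonneg _ _ _ _ _ _ _ _ _)) (hA0 _)
  have h₄ : (0 : Finset V → R) ≤
      fun W => ν W * cellWt4 p r u q (bp || bp') (br || br') (bu || bu') (bq || bq') W * A (W ∪ (X ∪ Y)) :=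
    fun W => mul_nonneg (mul_nonneg (hν0 W) (cellWt4_nonneg _ _ _ _ _ _ _ _ _)) (hA0 _)
  have h : ∀ ⦃s : Finset V⦄, s ⊆ U → ∀ ⦃t : Finset V⦄, t ⊆ U →
      (fun W => ν W * cellWt4 p r u q bp br bu bq W * A (W ∪ X)) s *
        (fun W => ν W * cellWt4 p r u q bp' br' bu' bq' W * A (W ∪ Y)) t ≤
      (fun W => ν W * cellWt4 p r u q (bp && bp') (br && br') (bu && bu') (bq && bq') W * A (W ∪ (X ∩ Y)))
          (s ∩ t) *
        (fun W => ν W * cellWt4 p r u q (bp || bp') (br || br') (bu || bu') (bq || bq') W * A (W ∪ (X ∪ Y)))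
          (s ∪ t) := by
    intro s hs t ht
    simp only
    have hAA : A (s ∪ X) * A (t ∪ Y) ≤ A ((s ∩ t) ∪ (X ∩ Y)) * A ((s ∪ t) ∪ (X ∪ Y)) := by
      have := hA (s ∪ X) (t ∪ Y)
      rwa [union_inter_union_of_disjoint hs ht hXU hYU, union_union_union_eq] at this
    calc ν s * cellWt4 p r u q bp br bu bq s * A (s ∪ X) *
          (ν t * cellWt4 p r u q bp' br' bu' bq' t * A (t ∪ Y))
        = (ν s * ν t) * (cellWt4 p r u q bp br bu bq s * cellWt4 p r u q bp' br' bu' bq' t) *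
            (A (s ∪ X) * A (t ∪ Y)) := by ring
      _ ≤ (ν (s ∩ t) * ν (s ∪ t)) *
            (cellWt4 p r u q (bp && bp') (br && br') (bu && bu') (bq && bq') (s ∩ t) *
              cellWt4 p r u q (bp || bp') (br || br') (bu || bu') (bq || bq') (s ∪ t)) *
            (A ((s ∩ t) ∪ (X ∩ Y)) * A ((s ∪ t) ∪ (X ∪ Y))) := by
          apply mul_le_mul
          · apply mul_le_mul (hν s hs t ht) (cellWt4_mul_le p r u q bp br bu bq bp' br' bu' bq' s t)
            · exact mul_nonneg (cellWt4_nonneg _ _ _ _ _ _ _ _ _) (cellWt4_nonneg _ _ _ _ _ _ _ _ _)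
            · exact mul_nonneg (hν0 _) (hν0 _)
          · exact hAA
          · exact mul_nonneg (hA0 _) (hA0 _)
          · exact mul_nonneg (mul_nonneg (hν0 _) (hν0 _))
              (mul_nonneg (cellWt4_nonneg _ _ _ _ _ _ _ _ _) (cellWt4_nonneg _ _ _ _ _ _ _ _ _))
      _ = ν (s ∩ t) * cellWt4 p r u q (bp && bp') (br && br') (bu && bu') (bq && bq') (s ∩ t) *
            A ((s ∩ t) ∪ (X ∩ Y)) *
            (ν (s ∪ t) * cellWt4 p r u q (bp || bp') (br || br') (bu || bu') (bq || bq') (s ∪ t) *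
              A ((s ∪ t) ∪ (X ∪ Y))) := by
          ring
  have key := Finset.four_functions_theorem U h₁ h₂ h₃ h₄ h
    (𝒜 := U.powerset) (ℬ := U.powerset) le_rfl le_rfl
  simpa only [Finset.powerset_infs_powerset_self, Finset.powerset_sups_powerset_self] using key

/-- **The monotone step of the four-marker cell sums.** -/
theorem cellSum4_mono (U : Finset V) (ν A : Finset V → R) (p r u q : V)
    (hν0 : ∀ W, 0 ≤ ν W) (hAmono : ∀ s t : Finset V, s ⊆ t → A t ≤ A s)
    (bp br bu bq : Bool) (X Y : Finset V) (hXY : X ⊆ Y) :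
    cellSum4 U ν A p r u q bp br bu bq Y ≤ cellSum4 U ν A p r u q bp br bu bq X := by
  unfold cellSum4
  apply Finset.sum_le_sum
  intro W _
  exact mul_le_mul_of_nonneg_left (hAmono _ _ (Finset.union_subset_union_right hXY))
    (mul_nonneg (hν0 W) (cellWt4_nonneg _ _ _ _ _ _ _ _ _))

/-- The four-marker cell sums are nonnegative. -/
lemma cellSum4_nonneg (U : Finset V) (ν A : Finset V → R) (p r u q : V)
    (hν0 : ∀ W, 0 ≤ ν W) (hA0 : ∀ W, 0 ≤ A W) (bp br bu bq : Bool) (X : Finset V) :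
    0 ≤ cellSum4 U ν A p r u q bp br bu bq X :=
  Finset.sum_nonneg fun W _ =>
    mul_nonneg (mul_nonneg (hν0 W) (cellWt4_nonneg _ _ _ _ _ _ _ _ _)) (hA0 _)

/-- The good-set weight of a chain `p ← r ← u`: `1` if `u ∈ W → r ∈ W` and `r ∈ W → p ∈ W`. -/
def goodWt2 (p r u : V) (W : Finset V) : R := if ((u ∈ W → r ∈ W) ∧ (r ∈ W → p ∈ W)) then 1 else 0

omit [LinearOrder R] [IsStrictOrderedRing R] in
/-- A sum of `ν`-weighted terms can be restricted to the good sets when `ν` vanishes on the bad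
ones (two chain conditions). -/
lemma sum_eq_sum_goodWt2 (U : Finset V) (ν : Finset V → R) (p r u : V)
    (hbad : ∀ W ⊆ U, ¬ ((u ∈ W → r ∈ W) ∧ (r ∈ W → p ∈ W)) → ν W = 0) (f : Finset V → R) :
    ∑ W ∈ U.powerset, ν W * f W = ∑ W ∈ U.powerset, ν W * goodWt2 (R := R) p r u W * f W := by
  refine Finset.sum_congr rfl fun W hW => ?_
  unfold goodWt2
  split_ifs with hg
  · ring
  · rw [hbad W (Finset.mem_powerset.1 hW) hg]
    ring

omit [LinearOrder R] [IsStrictOrderedRing R] in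
/-- The marker variant of `sum_eq_sum_goodWt2`. -/
lemma sum_eq_sum_goodWt2' (U : Finset V) (ν : Finset V → R) (p r u : V)
    (hbad : ∀ W ⊆ U, ¬ ((u ∈ W → r ∈ W) ∧ (r ∈ W → p ∈ W)) → ν W = 0) (f m : Finset V → R) :
    ∑ W ∈ U.powerset, ν W * f W * m W =
      ∑ W ∈ U.powerset, ν W * goodWt2 (R := R) p r u W * f W * m W := by
  refine Finset.sum_congr rfl fun W hW => ?_
  unfold goodWt2
  split_ifs with hg
  · ring
  · rw [hbad W (Finset.mem_powerset.1 hW) hg]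
    ring

end OrTail4Cells

end Summit.Ventures.PercRepro2.Coin
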